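import Mathlib
import Summits.Ventures.PercRepro2.PointSplitBHK
import Summits.Ventures.PercRepro2.DisagreementSum

/-!
# The pair form of the point-split candidates:
`(PS1) ⟺ E[(F(W) − F(W′))(G(W) − G(W′))·(1_{v ∈ W} + 1_{v ∈ W′})] ≥ 0`
(blind cell PercRepro2, night-3 g23, 2026-08-28; `proofs/NIGHT3-CERT.md` §32.7)

For two independent copies `W = C_s(ω)`, `W′ = C_s(ω′)` of the cluster (both on `{s ↮ X}`) write
`D(ω, ω′) = (F(W) − F(W′))·(G(W) − G(W′))` for the PAIR DISCREPANCY of two increasing functionals —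
nonnegative whenever `W, W′` are comparable.  For weights `w₁, w₂` the polarised form of
`PointSplitBHK.lean` at `X = Y` is a two-copy bilinear form (`biForm` of `DisagreementSum.lean`):

  **`biForm p p (D · (w₁(ω)w₂(ω′) + w₂(ω)w₁(ω′)) · 1_X(ω)1_X(ω′)) = 2·M(w₁, w₂)`**
  (`biForm_pairKernel_eq_mixedForm`),

so, in words (`μ` the cluster law on `{s ↮ X}`, `W, W′` iid):
* BHK (`w₁ = w₂ = 1`): `E[D] ≥ 0` — the classical pair form of positive association;
* (PS) (`w₁ = 1_{v ∈ ·}`, `w₂ = 1_{v ∉ ·}`): `E[D · 1{v ∈ exactly one of W, W′}] ≥ 0`;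
* (PS1) (`w₁ = 1_{v ∈ ·}`, `w₂ = 1`): `E[D · (1_{v ∈ W} + 1_{v ∈ W′})] ≥ 0`;
* the class slacks: `2S_{1_{v ∈ ·}} = E[D · 1{v ∈ both}]/1`, `2S_{1_{v ∉ ·}} = E[D · 1{v ∈ neither}]`.

The negative contributions to every one of these come from INCOMPARABLE pairs; (PS) says that the
pairs disagreeing on `v` have nonnegative mean discrepancy by themselves.  Own work; standard axioms.
-/

namespace Summit.Ventures.PercRepro2

open UnionCluster

namespace CovForm

namespace PointSplit

variable {V : Type*} {E : Type*} [Fintype E] [DecidableEq E]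
  {R : Type*} [Field R] [LinearOrder R] [IsStrictOrderedRing R]

/-! ## `biForm` of product kernels -/

omit [LinearOrder R] [IsStrictOrderedRing R] in
/-- `biForm` of a product kernel `f(x)·g(y)` is the product of the expectations. -/
lemma biForm_mul_fun (p : E → R) (f g : Config E → R) :
    biForm p p (fun x y => f x * g y) = expect p f * expect p g := by
  unfold biForm expect
  rw [Finset.sum_mul_sum]
  refine Finset.sum_congr rfl fun x _ => Finset.sum_congr rfl fun y _ => ?_
  ring

omit [LinearOrder R] [IsStrictOrderedRing R] in
/-- `biForm` is additive in the kernel (local copy of g22's `biForm_add`, same weights). -/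
lemma biForm_add_fun (p : E → R) (K₁ K₂ : Config E → Config E → R) :
    biForm p p (fun x y => K₁ x y + K₂ x y) = biForm p p K₁ + biForm p p K₂ := by
  unfold biForm
  rw [← Finset.sum_add_distrib]
  refine Finset.sum_congr rfl fun x _ => ?_
  rw [← Finset.sum_add_distrib]
  refine Finset.sum_congr rfl fun y _ => ?_
  ring

omit [LinearOrder R] [IsStrictOrderedRing R] in
/-- `biForm` of a difference of kernels. -/
lemma biForm_sub_fun (p : E → R) (K₁ K₂ : Config E → Config E → R) :
    biForm p p (fun x y => K₁ x y - K₂ x y) = biForm p p K₁ - biForm p p K₂ := by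
  unfold biForm
  rw [← Finset.sum_sub_distrib]
  refine Finset.sum_congr rfl fun x _ => ?_
  rw [← Finset.sum_sub_distrib]
  refine Finset.sum_congr rfl fun y _ => ?_
  ring

/-! ## The pair kernel -/

/-- The pair kernel: the discrepancy `(F(C_s(x)) − F(C_s(y)))·(G(C_s(x)) − G(C_s(y)))` times the
symmetrised pair weight `w₁(x)w₂(y) + w₂(x)w₁(y)`, both copies on `{s ↮ X}`. -/
noncomputable def pairKernel (ends : E → Sym2 V) (s : V) (X : Finset V) (F G : Set V → R)
    (w₁ w₂ : Config E → R) (x y : Config E) : R :=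
  (F (cluster ends x s) - F (cluster ends y s)) * (G (cluster ends x s) - G (cluster ends y s)) *
    (w₁ x * w₂ y + w₂ x * w₁ y) * ((avoidAll ends s X).indicator 1 x *
      (avoidAll ends s X).indicator 1 y)

omit [LinearOrder R] [IsStrictOrderedRing R] in
/-- **The pair form of the polarised BHK slack at `X = Y`**:
`biForm p p (pairKernel) = 2·M(w₁, w₂)`. -/
theorem biForm_pairKernel_eq_mixedForm [DecidableEq V] (p : E → R) (ends : E → Sym2 V) (s : V)
    (X : Finset V) (F G : Set V → R) (w₁ w₂ : Config E → R) :
    biForm p p (pairKernel ends s X F G w₁ w₂) = 2 * mixedFormW p ends s X X F G w₁ w₂ := by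
  -- the eight product terms of the kernel
  set I := (avoidAll ends s X).indicator (1 : Config E → R) with hI
  set f₁ : Config E → R := fun x => F (cluster ends x s) * G (cluster ends x s) * w₁ x * I x
  set f₂ : Config E → R := fun x => F (cluster ends x s) * G (cluster ends x s) * w₂ x * I x
  set a₁ : Config E → R := fun x => w₁ x * I x
  set a₂ : Config E → R := fun x => w₂ x * I x
  set b₁ : Config E → R := fun x => F (cluster ends x s) * w₁ x * I x
  set b₂ : Config E → R := fun x => F (cluster ends x s) * w₂ x * I x
  set c₁ : Config E → R := fun x => G (cluster ends x s) * w₁ x * I x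
  set c₂ : Config E → R := fun x => G (cluster ends x s) * w₂ x * I x
  have hK : pairKernel ends s X F G w₁ w₂ = fun x y =>
      ((f₁ x * a₂ y + f₂ x * a₁ y) + (a₁ x * f₂ y + a₂ x * f₁ y)) -
        ((b₁ x * c₂ y + b₂ x * c₁ y) + (c₁ x * b₂ y + c₂ x * b₁ y)) := by
    funext x y
    simp only [pairKernel, f₁, f₂, a₁, a₂, b₁, b₂, c₁, c₂, I]
    ring
  rw [hK, biForm_sub_fun, biForm_add_fun, biForm_add_fun, biForm_add_fun, biForm_add_fun,
    biForm_add_fun, biForm_add_fun, biForm_mul_fun, biForm_mul_fun, biForm_mul_fun, biForm_mul_fun,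
    biForm_mul_fun, biForm_mul_fun, biForm_mul_fun, biForm_mul_fun]
  unfold mixedFormW wExpect
  simp only [Finset.inter_self, Finset.union_self]
  have e1 : expect p f₁ = expect p (fun ω => F (cluster ends ω s) * G (cluster ends ω s) * w₁ ω *
      (avoidAll ends s X).indicator 1 ω) := rfl
  have e2 : expect p f₂ = expect p (fun ω => F (cluster ends ω s) * G (cluster ends ω s) * w₂ ω *
      (avoidAll ends s X).indicator 1 ω) := rfl
  have e3 : expect p a₁ = expect p (fun ω => (fun _ : Set V => (1 : R)) (cluster ends ω s) * w₁ ω *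
      (avoidAll ends s X).indicator 1 ω) := by
    refine congrArg _ (funext fun ω => ?_)
    simp only [a₁, hI]
    ring
  have e4 : expect p a₂ = expect p (fun ω => (fun _ : Set V => (1 : R)) (cluster ends ω s) * w₂ ω *
      (avoidAll ends s X).indicator 1 ω) := by
    refine congrArg _ (funext fun ω => ?_)
    simp only [a₂, hI]
    ring
  rw [e1, e2, e3, e4]
  simp only [b₁, b₂, c₁, c₂]
  ring

/-! ## The three readings -/

omit [LinearOrder R] [IsStrictOrderedRing R] in
/-- **BHK as a pair form**: `biForm p p (D · 1_X(x)1_X(y)) = 2·S_1(F, G)` (with `w₁ = w₂ = 1`,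
`w₁w₂ + w₂w₁ = 2`). -/
theorem biForm_pair_one [DecidableEq V] (p : E → R) (ends : E → Sym2 V) (s : V) (X : Finset V)
    (F G : Set V → R) :
    biForm p p (pairKernel ends s X F G (fun _ => 1) (fun _ => 1)) =
      4 * bhkFormW p ends s X X F G (fun _ => 1) := by
  rw [biForm_pairKernel_eq_mixedForm, mixedFormW_self]
  ring

omit [LinearOrder R] [IsStrictOrderedRing R] in
/-- **(PS) as a pair form**: with `w₁ = 1_{v ∈ C_s}`, `w₂ = 1_{v ∉ C_s}` the pair weight is
`1{v in exactly one of the two clusters}`, and `biForm = 2·M(1_{vH}, 1_{v̄H})`. -/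
theorem biForm_pair_split [DecidableEq V] (p : E → R) (ends : E → Sym2 V) (s v : V) (X : Finset V)
    (F G : Set V → R) :
    biForm p p (pairKernel ends s X F G ((connEvent ends s v).indicator 1)
        (((connEvent ends s v)ᶜ).indicator 1)) =
      2 * mixedFormW p ends s X X F G ((connEvent ends s v).indicator 1)
        (((connEvent ends s v)ᶜ).indicator 1) :=
  biForm_pairKernel_eq_mixedForm p ends s X F G _ _

omit [LinearOrder R] [IsStrictOrderedRing R] in
/-- **(PS1) as a pair form**: with `w₁ = 1_{v ∈ C_s}`, `w₂ = 1` the pair weight is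
`1_{v ∈ W} + 1_{v ∈ W′}`, and `biForm = 2·M(1_{vH}, 1)`. -/
theorem biForm_pair_one_split [DecidableEq V] (p : E → R) (ends : E → Sym2 V) (s v : V)
    (X : Finset V) (F G : Set V → R) :
    biForm p p (pairKernel ends s X F G ((connEvent ends s v).indicator 1) (fun _ => 1)) =
      2 * mixedFormW p ends s X X F G ((connEvent ends s v).indicator 1) (fun _ => 1) :=
  biForm_pairKernel_eq_mixedForm p ends s X F G _ _

omit [Fintype E] [DecidableEq E] in
/-- The discrepancy of two comparable clusters is nonnegative for increasing `F, G`: the negative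
contributions to every pair form come from incomparable pairs only. -/
lemma discrepancy_nonneg_of_subset {F G : Set V → R} (hF : Monotone F) (hG : Monotone G)
    {W W' : Set V} (h : W ⊆ W') :
    0 ≤ (F W' - F W) * (G W' - G W) :=
  mul_nonneg (sub_nonneg.2 (hF h)) (sub_nonneg.2 (hG h))

end PointSplit

end CovForm

end Summit.Ventures.PercRepro2
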